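import Mathlib
import HarnessLib
import Summits.HubbardSuperconductivity.HubbardSuperconductivity.Theorems.KLProgrammeKLRegimeEngineTwoLegSpLegStepSplitRates

/-!
# Geometric private rates `d·4^m` for the two-leg nested legs: the two arithmetic facts (cell gate-hubbard-kl, seat hubbard-kl-k3c5-p2 g7)

The induction vehicle of rows C1/C2 (`…EngineTwoLegSpLegStepSplitRates`, r2d-p1's `…CutLegStepSplit`) runs on private rates `a m`; the packaging matched
to the registered ceiling `Q.CL β n = Q.CL β 0·4^n` is `a m = d·4^m`.  Two facts used by the composed interfaces (`…SpLegDualDataFour`, `…CutLegDualData`):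
* `sum_range_mul_four_pow` — `F_n = Σ_{m<n} d·4^m = d(4^n − 1)/3`;
* `sum_geometricRatesFour_le_klScale_mul` — the frame-distance tube of these rates sits inside the scale-`n` shell, `F_n ≤ Λ_n·L`, as soon as
  `(32/3)·d·16^n ≤ L` (`Λ_n = 4^{-n}/32`; the side condition `hFΛ` of the `_sepTubeGradient` doors).
Proofs only; no definitions.  References: BGM 2006 §2.4 (2.23) [cite: BenfattoGiulianiMastropietro2006].
-/

noncomputable section

namespace Summit.HubbardSuperconductivity.HubbardSuperconductivity.Theorems.EngineV8

set_option linter.dupNamespace false -- summit = problem name (single-conjunct summit), D-0017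

open Real Finset Summit.HubbardSuperconductivity.HubbardSuperconductivity.Theorems.KLProgrammeLegKernels
open Summit.HubbardSuperconductivity.HubbardSuperconductivity.Theorems.KLRegimeSplit

/-- The maximal geometric private rates `a m = d·4^m`: `F_n = Σ_{m<n} d·4^m = d·(4^n − 1)/3`. -/
theorem sum_range_mul_four_pow (d : ℝ) (n : ℕ) : ∑ m ∈ range n, d * (4 : ℝ) ^ m = d * ((4 : ℝ) ^ n - 1) / 3 := by
  rw [← mul_sum, geom_sum_eq (by norm_num : (4 : ℝ) ≠ 1) n]
  ring

/-- **The frame-distance tube of the rates `d·4^m` sits inside the shell**: `(32/3)·d·16^n ≤ L ⟹ Σ_{m<n} d·4^m ≤ Λ_n·L` (`0 ≤ d`). -/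
theorem sum_geometricRatesFour_le_klScale_mul {d : ℝ} (hd : 0 ≤ d) {n : ℕ} {Lr : ℝ} (hL : 32 / 3 * d * (16 : ℝ) ^ n ≤ Lr) :
    ∑ m ∈ range n, d * (4 : ℝ) ^ m ≤ klScale klE0 n * Lr := by
  rw [sum_range_mul_four_pow]
  unfold klScale klE0
  have h4 : (0 : ℝ) < (4 : ℝ) ^ n := by positivity
  have h16 : (16 : ℝ) ^ n = (4 : ℝ) ^ n * (4 : ℝ) ^ n := by rw [← mul_pow]; norm_num
  rw [h16] at hL
  have h3 : (0 : ℝ) ≤ d * (4 : ℝ) ^ n := by positivity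
  have hkey : d * (4 : ℝ) ^ n / 3 ≤ 1 / 32 * ((4 : ℝ) ^ n)⁻¹ * Lr := by
    rw [show 1 / 32 * ((4 : ℝ) ^ n)⁻¹ * Lr = Lr / (32 * (4 : ℝ) ^ n) by field_simp, le_div_iff₀ (by positivity)]
    nlinarith
  have hsub : d * ((4 : ℝ) ^ n - 1) / 3 ≤ d * (4 : ℝ) ^ n / 3 := by nlinarith
  exact hsub.trans hkey

end Summit.HubbardSuperconductivity.HubbardSuperconductivity.Theorems.EngineV8

end
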